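import Literature.Computability.Complexity.TM2Simulation
import HarnessLib

/-!
# The disjunction of two deciders on the same input, in Mathlib's TM2 model

Trunk `CplxCore`, toolkit for `TimeBounds.lean` (sibling of `TimeBoundsProofs.lean`: sequential
composition; `TM2Iterate.lean`: clocked iteration; `TM2Simulation.lean`: statement lifting).
Main result:

* `Turing.TM2ComputableAux.orMachine M₁ M₂` and `Turing.TM2ComputableAux.or_outputsWithin`: if
  `M₁ : TM2ComputableAux Γ₀ Bool` maps the word `l` to the one-bit word `[b₁]` within `m₁` steps
  and `M₂ : TM2ComputableAux Γ₀ Bool` maps `l` to `[b₂]` within `m₂` steps, then the machine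
  `M₁.orMachine M₂` maps `l` to `[b₁ || b₂]` within `m₁ + m₂ + 2 |l| + 4` steps.

This is the machine-level closure property "run two subroutines on the same input and combine
the answers in the finite control" (Arora–Barak 2009, §1.3: multi-tape machines running machines
as subroutines; Claim 1.6), with *additive* running time, as needed for fine-grained statements
(it discharges `Literature.Computability.FineGrained.computesInTime_or`, the composition of the two branches of the
k-SAT algorithm of Impagliazzo–Paturi 2001, Theorem 3). Nothing of this is in Mathlib, whose only
timed TM2 machine is the identity.

## The machine (`TM2Or.orTM`)

Given bundled machines `M₁ M₂ : Turing.FinTM2` with input alphabets identified with `A`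
(`e₁`, `e₂`) and output alphabets identified with `Bool` (`o₁`, `o₂`), the disjunction machine
has stacks `(M₁.K ⊕ M₂.K) ⊕ Aux` with two auxiliary stacks `IN` (its input stack) and `TMP`
(both of alphabet `A`), labels `(M₁.Λ ⊕ M₂.Λ) ⊕ Ctrl` with four control labels, and states
`M₁.σ × M₂.σ × Option A × Bool` (the states of the two machines, a register for one symbol in
transit, a register for the first answer bit). Its output stack is the output stack of `M₂`.
Control flow (`TM2Or.ctrlStmt`):

* `init1`: pour `IN` onto `TMP`; `init2`: pop `TMP`, pushing each symbol on the input stacks of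
  both `M₁` and `M₂` (two reversals restore the order), then jump to `M₁.main`;
* the statements of `M₁` (lifted along `inl ∘ inl` by `TM2Lift.liftStmt`, `halt ↦ goto mid`);
  since `M₁` halts in Mathlib's `haltList` form, at `mid` its output stack holds `[b₁]` and its
  other stacks are empty: `mid` pops `b₁` into the bit register and jumps to `M₂.main`;
* the statements of `M₂` (lifted along `inl ∘ inr`, `halt ↦ goto fin`); at `fin` the output
  stack of `M₂` holds `[b₂]`: `fin` pops it, pushes `b₁ || b₂`, resets the state and halts —
  exactly Mathlib's `haltList` convention, all other stacks being empty again.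

## Proof architecture

Configurations are written `TM2Or.cfg l v₁ v₂ r b S₁ S₂ i t` (`TM2Or.mkStk`: stacks of `M₁`,
stacks of `M₂`, `IN`, `TMP`, with `Function.update` lemmas for any decidability instance);
one-step lemmas for the control labels by `simp`; the phases `init1_run`, `init2_run` by
induction on the moved word; runs of `M₁`/`M₂` are transported by `TM2Lift.iterate_lift`
through the characterisations `embeds₁_iff`/`embeds₂_iff` of `TM2Lift.Embeds` in terms of `cfg`;
the pieces are chained with `TM2Iter.ReachesIn`.

## References

* S. Arora, B. Barak, *Computational Complexity: A Modern Approach*, CUP 2009, §1.3 (machine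
  constructions: subroutines on multi-tape machines), Claim 1.6. doi:10.1017/cbo9780511804090
* R. Impagliazzo, R. Paturi, *On the complexity of k-SAT*, JCSS 62 (2001), proof of Theorem 3
  (the application).
* Mathlib, `Mathlib/Computability/TuringMachine/Computable.lean` (`FinTM2`, `initList`,
  `haltList`, `TM2OutputsInTime`).
-/

namespace Literature.Computability.Complexity.TM2Or

open Turing StateTransition Function TM2Comp TM2Iter TM2Lift

/-! ### Auxiliary stacks, control labels, alphabets, states -/

/-- The two auxiliary stacks of the disjunction machine: its input stack `IN` and the transfer
stack `TMP` (both of alphabet `A`). [folklore] -/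
inductive Aux
  | IN
  | TMP
  deriving DecidableEq, Fintype

/-- The control labels of the disjunction machine (besides the labels of the two machines).
[folklore] -/
inductive Ctrl
  | init1
  | init2
  | mid
  | fin
  deriving DecidableEq, Fintype

section Machine

variable {K₁ K₂ : Type} {G₁ : K₁ → Type} {G₂ : K₂ → Type} {Λ₁ Λ₂ σ₁ σ₂ A : Type}

/-- Stack alphabets of the disjunction machine: those of `M₁` on `inl ∘ inl`, those of `M₂` on
`inl ∘ inr`, and `A` on the two auxiliary stacks. Written with `casesOn` so that it unfolds by
`rfl` on constructors. [folklore] -/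
abbrev OrΓ (G₁ : K₁ → Type) (G₂ : K₂ → Type) (A : Type) : (K₁ ⊕ K₂) ⊕ Aux → Type := fun j =>
  Sum.casesOn (motive := fun _ => Type) j
    (fun j' => Sum.casesOn (motive := fun _ => Type) j' G₁ G₂) (fun _ => A)

/-- Internal states of the disjunction machine: the states of the two machines, a register for
one symbol in transit (`none` between steps) and a register for the first answer bit. [folklore] -/
abbrev St (σ₁ σ₂ A : Type) : Type := σ₁ × σ₂ × Option A × Bool

/-- The lens of the composite states onto the states of `M₁`. [folklore] -/
def set₁ (v : St σ₁ σ₂ A) (s : σ₁) : St σ₁ σ₂ A := (s, v.2)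

/-- The lens of the composite states onto the states of `M₂`. [folklore] -/
def set₂ (v : St σ₁ σ₂ A) (s : σ₂) : St σ₁ σ₂ A := (v.1, s, v.2.2)

/-- `set₁` is a lawful lens. [folklore] -/
theorem lens₁ : LawfulLens (fun v : St σ₁ σ₂ A => v.1) set₁ :=
  ⟨fun _ _ => rfl, fun _ _ _ => rfl, fun _ => rfl⟩

/-- `set₂` is a lawful lens. [folklore] -/
theorem lens₂ : LawfulLens (fun v : St σ₁ σ₂ A => v.2.1) set₂ :=
  ⟨fun _ _ => rfl, fun _ _ _ => rfl, fun _ => rfl⟩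

/-- Extract the symbol in transit (junk value `default` if there is none). [folklore] -/
def rget [Inhabited A] (v : St σ₁ σ₂ A) : A := v.2.2.1.getD default

/-- Reset the symbol register. [folklore] -/
def rst (v : St σ₁ σ₂ A) : St σ₁ σ₂ A := (v.1, v.2.1, none, v.2.2.2)

/-- Stack contents of the disjunction machine from the stacks `S₁` of `M₁`, `S₂` of `M₂` and the
contents `i`, `t` of `IN`, `TMP`. [folklore] -/
def mkStk (S₁ : ∀ k, List (G₁ k)) (S₂ : ∀ k, List (G₂ k)) (i t : List A) :
    ∀ j : (K₁ ⊕ K₂) ⊕ Aux, List (OrΓ G₁ G₂ A j)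
  | Sum.inl (Sum.inl k) => S₁ k
  | Sum.inl (Sum.inr k) => S₂ k
  | Sum.inr Aux.IN => i
  | Sum.inr Aux.TMP => t

section StkLemmas

variable (S₁ : ∀ k, List (G₁ k)) (S₂ : ∀ k, List (G₂ k)) (i t : List A)

/-- Reading a stack of `M₁`. [folklore] -/
@[simp] theorem mkStk_inl_inl (k : K₁) : mkStk S₁ S₂ i t (Sum.inl (Sum.inl k)) = S₁ k := rfl
/-- Reading a stack of `M₂`. [folklore] -/
@[simp] theorem mkStk_inl_inr (k : K₂) : mkStk S₁ S₂ i t (Sum.inl (Sum.inr k)) = S₂ k := rfl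
/-- Reading `IN`. [folklore] -/
@[simp] theorem mkStk_IN : mkStk S₁ S₂ i t (Sum.inr Aux.IN) = i := rfl
/-- Reading `TMP`. [folklore] -/
@[simp] theorem mkStk_TMP : mkStk S₁ S₂ i t (Sum.inr Aux.TMP) = t := rfl

/-- The stacks of `M₁`, read back. [folklore] -/
theorem mkStk_comp_inl_inl : (fun k => mkStk S₁ S₂ i t (Sum.inl (Sum.inl k))) = S₁ := rfl
/-- The stacks of `M₂`, read back. [folklore] -/
theorem mkStk_comp_inl_inr : (fun k => mkStk S₁ S₂ i t (Sum.inl (Sum.inr k))) = S₂ := rfl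

variable {dK : DecidableEq ((K₁ ⊕ K₂) ⊕ Aux)}

/-- Writing a stack of `M₁` (any decidability instance, so that the lemma also fires on the
instance bundled in a `FinTM2`). [folklore] -/
@[simp] theorem mkStk_update_inl_inl [DecidableEq K₁] (k : K₁) (L : List (G₁ k)) :
    @update _ _ dK (mkStk S₁ S₂ i t) (Sum.inl (Sum.inl k)) L = mkStk (update S₁ k L) S₂ i t := by
  funext j
  rcases j with (k' | k') | a
  · rcases eq_or_ne k' k with rfl | h
    · simp
    · rw [update_of_ne (by simpa using h)]; simp [update_of_ne h]
  · rw [update_of_ne (by simp)]; rfl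
  · rw [update_of_ne (by simp)]; cases a <;> rfl

/-- Writing a stack of `M₂`. [folklore] -/
@[simp] theorem mkStk_update_inl_inr [DecidableEq K₂] (k : K₂) (L : List (G₂ k)) :
    @update _ _ dK (mkStk S₁ S₂ i t) (Sum.inl (Sum.inr k)) L = mkStk S₁ (update S₂ k L) i t := by
  funext j
  rcases j with (k' | k') | a
  · rw [update_of_ne (by simp)]; rfl
  · rcases eq_or_ne k' k with rfl | h
    · simp
    · rw [update_of_ne (by simpa using h)]; simp [update_of_ne h]
  · rw [update_of_ne (by simp)]; cases a <;> rfl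

/-- Writing `IN`. [folklore] -/
@[simp] theorem mkStk_update_IN (i' : List A) :
    @update _ _ dK (mkStk S₁ S₂ i t) (Sum.inr Aux.IN) i' = mkStk S₁ S₂ i' t := by
  funext j
  rcases j with (k' | k') | a
  · rw [update_of_ne (by simp)]; rfl
  · rw [update_of_ne (by simp)]; rfl
  · cases a
    · simp
    · rw [update_of_ne (by simp)]; rfl

/-- Writing `TMP`. [folklore] -/
@[simp] theorem mkStk_update_TMP (t' : List A) :
    @update _ _ dK (mkStk S₁ S₂ i t) (Sum.inr Aux.TMP) t' = mkStk S₁ S₂ i t' := by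
  funext j
  rcases j with (k' | k') | a
  · rw [update_of_ne (by simp)]; rfl
  · rw [update_of_ne (by simp)]; rfl
  · cases a
    · rw [update_of_ne (by simp)]; rfl
    · simp

/-- The empty stack assignment. [folklore] -/
theorem mkStk_bot : mkStk (A := A) (fun k => ([] : List (G₁ k))) (fun k => ([] : List (G₂ k)))
    [] [] = fun j => ([] : List (OrΓ G₁ G₂ A j)) := by
  funext j
  rcases j with (k | k) | a
  · rfl
  · rfl
  · cases a <;> rfl

end StkLemmas

variable [Inhabited A] (k₀₁ k₁₁ : K₁) (k₀₂ k₁₂ : K₂) (e₁ : G₁ k₀₁ ≃ A) (o₁ : G₁ k₁₁ ≃ Bool)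
  (e₂ : G₂ k₀₂ ≃ A) (o₂ : G₂ k₁₂ ≃ Bool) (main₁ : Λ₁) (main₂ : Λ₂) (init₁ : σ₁) (init₂ : σ₂)

/-- The control statements of the disjunction machine.
* `init1`: pour the input stack `IN` onto `TMP`;
* `init2`: pop `TMP`, pushing each symbol onto the input stacks of both machines (through
  `e₁.symm`, `e₂.symm`), then start `M₁` at `main₁`;
* `mid`: pop the answer bit of `M₁` (read through `o₁`) into the bit register, start `M₂`;
* `fin`: pop the answer bit of `M₂`, push the disjunction of the two bits (through `o₂.symm`),
  reset the state and halt.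
The symbol register is reset before every jump. [folklore] -/
def ctrlStmt : Ctrl → TM2.Stmt (OrΓ G₁ G₂ A) ((Λ₁ ⊕ Λ₂) ⊕ Ctrl) (St σ₁ σ₂ A)
  | Ctrl.init1 =>
      TM2.Stmt.pop (Sum.inr Aux.IN) (fun v a => (v.1, v.2.1, a, v.2.2.2)) <|
        TM2.Stmt.branch (fun v => v.2.2.1.isNone)
          (TM2.Stmt.load rst <| TM2.Stmt.goto fun _ => Sum.inr Ctrl.init2)
          (TM2.Stmt.push (Sum.inr Aux.TMP) (fun v => rget v) <| TM2.Stmt.load rst <|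
            TM2.Stmt.goto fun _ => Sum.inr Ctrl.init1)
  | Ctrl.init2 =>
      TM2.Stmt.pop (Sum.inr Aux.TMP) (fun v a => (v.1, v.2.1, a, v.2.2.2)) <|
        TM2.Stmt.branch (fun v => v.2.2.1.isNone)
          (TM2.Stmt.load rst <| TM2.Stmt.goto fun _ => Sum.inl (Sum.inl main₁))
          (TM2.Stmt.push (Sum.inl (Sum.inl k₀₁)) (fun v => e₁.symm (rget v)) <|
            TM2.Stmt.push (Sum.inl (Sum.inr k₀₂)) (fun v => e₂.symm (rget v)) <|
            TM2.Stmt.load rst <| TM2.Stmt.goto fun _ => Sum.inr Ctrl.init2)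
  | Ctrl.mid =>
      TM2.Stmt.pop (Sum.inl (Sum.inl k₁₁))
          (fun v a => (v.1, v.2.1, none, (a.map o₁).getD false)) <|
        TM2.Stmt.goto fun _ => Sum.inl (Sum.inr main₂)
  | Ctrl.fin =>
      TM2.Stmt.pop (Sum.inl (Sum.inr k₁₂))
          (fun v a => (v.1, v.2.1, none, v.2.2.2 || (a.map o₂).getD false)) <|
        TM2.Stmt.push (Sum.inl (Sum.inr k₁₂)) (fun v => o₂.symm v.2.2.2) <|
        TM2.Stmt.load (fun _ => (init₁, init₂, none, false)) TM2.Stmt.halt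

end Machine

/-! ### Bundling: the disjunction machine as a `FinTM2` -/

section Bundled

variable (M₁ M₂ : FinTM2) (A : Type)

/-- Configurations of the disjunction machine, from the label, the two machine states, the two
registers, the stacks of the two machines and the two auxiliary stacks. [folklore] -/
def cfg (l : Option ((M₁.Λ ⊕ M₂.Λ) ⊕ Ctrl)) (v₁ : M₁.σ) (v₂ : M₂.σ) (r : Option A) (b : Bool)
    (S₁ : ∀ k, List (M₁.Γ k)) (S₂ : ∀ k, List (M₂.Γ k)) (i t : List A) :
    TM2.Cfg (OrΓ M₁.Γ M₂.Γ A) ((M₁.Λ ⊕ M₂.Λ) ⊕ Ctrl) (St M₁.σ M₂.σ A) :=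
  ⟨l, (v₁, v₂, r, b), mkStk S₁ S₂ i t⟩

/-- The (unbundled) type of configurations of the disjunction machine. [folklore] -/
abbrev OCfg : Type := TM2.Cfg (OrΓ M₁.Γ M₂.Γ A) ((M₁.Λ ⊕ M₂.Λ) ⊕ Ctrl) (St M₁.σ M₂.σ A)

variable {A} [Inhabited A] (e₁ : M₁.Γ M₁.k₀ ≃ A) (o₁ : M₁.Γ M₁.k₁ ≃ Bool)
  (e₂ : M₂.Γ M₂.k₀ ≃ A) (o₂ : M₂.Γ M₂.k₁ ≃ Bool)

/-- The program of the disjunction machine: lifted statements of `M₁` (halt ↦ `mid`), lifted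
statements of `M₂` (halt ↦ `fin`), control statements. [folklore] -/
def orStmt : (M₁.Λ ⊕ M₂.Λ) ⊕ Ctrl →
    TM2.Stmt (OrΓ M₁.Γ M₂.Γ A) ((M₁.Λ ⊕ M₂.Λ) ⊕ Ctrl) (St M₁.σ M₂.σ A)
  | Sum.inl (Sum.inl l) =>
      liftStmt (Γ' := OrΓ M₁.Γ M₂.Γ A) (fun k => Sum.inl (Sum.inl k))
        (fun l => Sum.inl (Sum.inl l)) (some (Sum.inr Ctrl.mid)) (fun v => v.1) set₁ (M₁.m l)
  | Sum.inl (Sum.inr l) =>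
      liftStmt (Γ' := OrΓ M₁.Γ M₂.Γ A) (fun k => Sum.inl (Sum.inr k))
        (fun l => Sum.inl (Sum.inr l)) (some (Sum.inr Ctrl.fin)) (fun v => v.2.1) set₂ (M₂.m l)
  | Sum.inr c => ctrlStmt M₁.k₀ M₁.k₁ M₂.k₀ M₂.k₁ e₁ o₁ e₂ o₂ M₁.main M₂.main
      M₁.initialState M₂.initialState c

/-- The disjunction machine of two bundled TM2 machines `M₁`, `M₂` whose input alphabets are
identified with `A` and whose output alphabets are identified with `Bool`: stacks
`(M₁.K ⊕ M₂.K) ⊕ Aux` (input stack `inr IN`, output stack `inl (inr M₂.k₁)`), labels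
`(M₁.Λ ⊕ M₂.Λ) ⊕ Ctrl` (main label `init1`), states `M₁.σ × M₂.σ × Option A × Bool`.
[cite: AroraBarak2009, §1.3 (multi-tape machine constructions; subroutines)] -/
noncomputable def orTM : FinTM2 :=
  letI := M₁.kFin; letI := M₁.ΛFin; letI := M₁.σFin; letI := M₁.Γk₀Fin
  letI := M₂.kFin; letI := M₂.ΛFin; letI := M₂.σFin
  letI : Fintype A := Fintype.ofEquiv _ e₁
  { K := (M₁.K ⊕ M₂.K) ⊕ Aux
    k₀ := Sum.inr Aux.IN
    k₁ := Sum.inl (Sum.inr M₂.k₁)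
    Γ := OrΓ M₁.Γ M₂.Γ A
    Λ := (M₁.Λ ⊕ M₂.Λ) ⊕ Ctrl
    main := Sum.inr Ctrl.init1
    σ := St M₁.σ M₂.σ A
    initialState := (M₁.initialState, M₂.initialState, none, false)
    Γk₀Fin := (inferInstance : Fintype A)
    m := orStmt M₁ M₂ e₁ o₁ e₂ o₂ }

/-- A step of the disjunction machine at a control label, unbundled. [folklore] -/
theorem step_inr (c : Ctrl) (var : St M₁.σ M₂.σ A) (stk : ∀ j, List (OrΓ M₁.Γ M₂.Γ A j)) :
    (orTM M₁ M₂ e₁ o₁ e₂ o₂).step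
        (⟨some (Sum.inr c), var, stk⟩ : OCfg M₁ M₂ A) =
      some (TM2.stepAux (ctrlStmt M₁.k₀ M₁.k₁ M₂.k₀ M₂.k₁ e₁ o₁ e₂ o₂ M₁.main M₂.main
        M₁.initialState M₂.initialState c) var stk) :=
  rfl

/-! ### Single steps of the control labels -/

section Steps

variable (v₁ : M₁.σ) (v₂ : M₂.σ) (b : Bool) (S₁ : ∀ k, List (M₁.Γ k)) (S₂ : ∀ k, List (M₂.Γ k))
  (i t : List A)

/-- `init1` on a nonempty input stack: move one symbol to `TMP`. [folklore] -/
theorem step_init1_cons (s : A) :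
    (orTM M₁ M₂ e₁ o₁ e₂ o₂).step (cfg M₁ M₂ A (some (Sum.inr Ctrl.init1)) v₁ v₂ none b S₁ S₂
        (s :: i) t) =
      some (cfg M₁ M₂ A (some (Sum.inr Ctrl.init1)) v₁ v₂ none b S₁ S₂ i (s :: t)) := by
  rw [cfg, step_inr]; simp [ctrlStmt, rst, rget, cfg]

/-- `init1` on the empty input stack: proceed to `init2`. [folklore] -/
theorem step_init1_nil :
    (orTM M₁ M₂ e₁ o₁ e₂ o₂).step (cfg M₁ M₂ A (some (Sum.inr Ctrl.init1)) v₁ v₂ none b S₁ S₂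
        [] t) =
      some (cfg M₁ M₂ A (some (Sum.inr Ctrl.init2)) v₁ v₂ none b S₁ S₂ [] t) := by
  rw [cfg, step_inr]; simp [ctrlStmt, rst, cfg]

/-- `init2` on nonempty `TMP`: push one symbol on the input stacks of both machines. [folklore] -/
theorem step_init2_cons (s : A) :
    (orTM M₁ M₂ e₁ o₁ e₂ o₂).step (cfg M₁ M₂ A (some (Sum.inr Ctrl.init2)) v₁ v₂ none b S₁ S₂
        i (s :: t)) =
      some (cfg M₁ M₂ A (some (Sum.inr Ctrl.init2)) v₁ v₂ none b
        (update S₁ M₁.k₀ (e₁.symm s :: S₁ M₁.k₀)) (update S₂ M₂.k₀ (e₂.symm s :: S₂ M₂.k₀))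
        i t) := by
  rw [cfg, step_inr]; simp [ctrlStmt, rst, rget, cfg]

/-- `init2` on empty `TMP`: jump to the main label of `M₁`. [folklore] -/
theorem step_init2_nil :
    (orTM M₁ M₂ e₁ o₁ e₂ o₂).step (cfg M₁ M₂ A (some (Sum.inr Ctrl.init2)) v₁ v₂ none b S₁ S₂
        i []) =
      some (cfg M₁ M₂ A (some (Sum.inl (Sum.inl M₁.main))) v₁ v₂ none b S₁ S₂ i []) := by
  rw [cfg, step_inr]; simp [ctrlStmt, rst, cfg]

/-- `mid`: pop the answer bit `b₁` of `M₁` into the bit register and jump to the main label of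
`M₂`. [folklore] -/
theorem step_mid (b₁ : Bool) :
    (orTM M₁ M₂ e₁ o₁ e₂ o₂).step (cfg M₁ M₂ A (some (Sum.inr Ctrl.mid)) v₁ v₂ none b
        (update S₁ M₁.k₁ [o₁.symm b₁]) S₂ i t) =
      some (cfg M₁ M₂ A (some (Sum.inl (Sum.inr M₂.main))) v₁ v₂ none b₁
        (update S₁ M₁.k₁ []) S₂ i t) := by
  rw [cfg, step_inr]; simp [ctrlStmt, cfg]

/-- `fin`: pop the answer bit `b₂` of `M₂`, push `b || b₂`, reset the state and halt. [folklore] -/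
theorem step_fin (b₂ : Bool) :
    (orTM M₁ M₂ e₁ o₁ e₂ o₂).step (cfg M₁ M₂ A (some (Sum.inr Ctrl.fin)) v₁ v₂ none b
        S₁ (update S₂ M₂.k₁ [o₂.symm b₂]) i t) =
      some (cfg M₁ M₂ A none M₁.initialState M₂.initialState none false
        S₁ (update S₂ M₂.k₁ [o₂.symm (b || b₂)]) i t) := by
  rw [cfg, step_inr]; simp [ctrlStmt, cfg]

end Steps

/-! ### Phases -/

section Phases

variable (v₁ : M₁.σ) (v₂ : M₂.σ) (b : Bool) (S₁ : ∀ k, List (M₁.Γ k)) (S₂ : ∀ k, List (M₂.Γ k))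

/-- `init1`: the input stack is poured (reversed) onto `TMP`, then the machine proceeds to
`init2`. [folklore] -/
theorem init1_run (i t : List A) :
    ReachesIn (C := OCfg M₁ M₂ A) (orTM M₁ M₂ e₁ o₁ e₂ o₂).step
      (cfg M₁ M₂ A (some (Sum.inr Ctrl.init1)) v₁ v₂ none b S₁ S₂ i t)
      (cfg M₁ M₂ A (some (Sum.inr Ctrl.init2)) v₁ v₂ none b S₁ S₂ [] (i.reverse ++ t))
      (i.length + 1) := by
  induction i generalizing t with
  | nil => simpa using ReachesIn.single (step_init1_nil M₁ M₂ e₁ o₁ e₂ o₂ v₁ v₂ b S₁ S₂ t)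
  | cons s i ih =>
    simpa [List.append_assoc] using
      ReachesIn.step_trans (step_init1_cons M₁ M₂ e₁ o₁ e₂ o₂ v₁ v₂ b S₁ S₂ i t s) (ih (s :: t))

/-- `init2`: `TMP` is poured (reversed, through `e₁.symm`, `e₂.symm`) on top of the input stacks
of both machines, then the machine jumps to the main label of `M₁`. [folklore] -/
theorem init2_run (i t : List A) :
    ReachesIn (C := OCfg M₁ M₂ A) (orTM M₁ M₂ e₁ o₁ e₂ o₂).step
      (cfg M₁ M₂ A (some (Sum.inr Ctrl.init2)) v₁ v₂ none b S₁ S₂ i t)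
      (cfg M₁ M₂ A (some (Sum.inl (Sum.inl M₁.main))) v₁ v₂ none b
        (update S₁ M₁.k₀ (t.reverse.map e₁.symm ++ S₁ M₁.k₀))
        (update S₂ M₂.k₀ (t.reverse.map e₂.symm ++ S₂ M₂.k₀)) i [])
      (t.length + 1) := by
  induction t generalizing S₁ S₂ with
  | nil =>
    simpa using ReachesIn.single (step_init2_nil M₁ M₂ e₁ o₁ e₂ o₂ v₁ v₂ b S₁ S₂ i)
  | cons s t ih =>
    have := ih (update S₁ M₁.k₀ (e₁.symm s :: S₁ M₁.k₀)) (update S₂ M₂.k₀ (e₂.symm s :: S₂ M₂.k₀))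
    rw [update_idem, update_self, update_idem, update_self] at this
    simpa [List.append_assoc] using
      ReachesIn.step_trans (step_init2_cons M₁ M₂ e₁ o₁ e₂ o₂ v₁ v₂ b S₁ S₂ i t s) this

end Phases

/-! ### Runs of the two embedded machines -/

section Runs

variable (v₁ : M₁.σ) (v₂ : M₂.σ) (r : Option A) (b : Bool) (S₁ : ∀ k, List (M₁.Γ k))
  (S₂ : ∀ k, List (M₂.Γ k)) (i t : List A)

omit [Inhabited A] in
/-- Embedded configurations of `M₁` are the configurations `cfg (liftLabel …) c.var v₂ r b c.stk
S₂ i t`. [folklore] -/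
theorem embeds₁_iff (c : M₁.Cfg) (c' : OCfg M₁ M₂ A) :
    Embeds (Γ' := OrΓ M₁.Γ M₂.Γ A) (fun k => Sum.inl (Sum.inl k)) (fun l => Sum.inl (Sum.inl l))
        (some (Sum.inr Ctrl.mid)) set₁ ((v₁, v₂, r, b) : St M₁.σ M₂.σ A) (mkStk S₁ S₂ i t) c c' ↔
      c' = ⟨liftLabel (fun l => Sum.inl (Sum.inl l)) (some (Sum.inr Ctrl.mid)) c.l,
        (c.var, v₂, r, b), mkStk c.stk S₂ i t⟩ := by
  constructor
  · rintro ⟨h1, h2, h3, h4⟩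
    obtain ⟨l', w, S'⟩ := c'
    simp only at h1 h2 h3 h4
    subst h1 h2
    congr
    funext j
    rcases j with (k | k) | a
    · exact h3 k
    · exact h4 (Sum.inl (Sum.inr k)) (fun k' h => by simp at h)
    · cases a <;> exact h4 (Sum.inr _) (fun k' h => by simp at h)
  · rintro rfl
    exact ⟨rfl, rfl, fun k => rfl, fun j hj => by
      rcases j with (k | k) | a
      · exact absurd rfl (hj k)
      · rfl
      · cases a <;> rfl⟩

omit [Inhabited A] in
/-- Embedded configurations of `M₂` are the configurations `cfg (liftLabel …) v₁ c.var r b S₁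
c.stk i t`. [folklore] -/
theorem embeds₂_iff (c : M₂.Cfg) (c' : OCfg M₁ M₂ A) :
    Embeds (Γ' := OrΓ M₁.Γ M₂.Γ A) (fun k => Sum.inl (Sum.inr k)) (fun l => Sum.inl (Sum.inr l))
        (some (Sum.inr Ctrl.fin)) set₂ ((v₁, v₂, r, b) : St M₁.σ M₂.σ A) (mkStk S₁ S₂ i t) c c' ↔
      c' = ⟨liftLabel (fun l => Sum.inl (Sum.inr l)) (some (Sum.inr Ctrl.fin)) c.l,
        (v₁, c.var, r, b), mkStk S₁ c.stk i t⟩ := by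
  constructor
  · rintro ⟨h1, h2, h3, h4⟩
    obtain ⟨l', w, S'⟩ := c'
    simp only at h1 h2 h3 h4
    subst h1 h2
    congr
    funext j
    rcases j with (k | k) | a
    · exact h4 (Sum.inl (Sum.inl k)) (fun k' h => by simp at h)
    · exact h3 k
    · cases a <;> exact h4 (Sum.inr _) (fun k' h => by simp at h)
  · rintro rfl
    exact ⟨rfl, rfl, fun k => rfl, fun j hj => by
      rcases j with (k | k) | a
      · rfl
      · exact absurd rfl (hj k)
      · cases a <;> rfl⟩

/-- `inl ∘ inl` is injective on stack indices. [folklore] -/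
theorem inl_inl_injective :
    Function.Injective (fun k : M₁.K => (Sum.inl (Sum.inl k) : (M₁.K ⊕ M₂.K) ⊕ Aux)) :=
  fun a b h => by simpa using h

/-- `inl ∘ inr` is injective on stack indices. [folklore] -/
theorem inl_inr_injective :
    Function.Injective (fun k : M₂.K => (Sum.inl (Sum.inr k) : (M₁.K ⊕ M₂.K) ⊕ Aux)) :=
  fun a b h => by simpa using h

/-- A single-stack update of the empty assignment with the empty word is the empty assignment.
[folklore] -/
theorem update_bot_nil {K : Type} [DecidableEq K] {G : K → Type} (a : K) :
    update (fun k => ([] : List (G k))) a [] = fun _ => [] := by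
  funext k
  rcases eq_or_ne k a with rfl | h
  · simp
  · rw [update_of_ne h]

/-- A run of `M₁` from `initList` to `haltList` is a run of the disjunction machine from the main
label of `M₁` (input on its input stack, its other stacks empty) to `mid` (answer on its output
stack, its other stacks empty), the rest being untouched. [folklore] -/
theorem run₁ {n : ℕ} {x : List (M₁.Γ M₁.k₀)} {y : List (M₁.Γ M₁.k₁)}
    (h : (flip bind M₁.step)^[n] (some (initList M₁ x)) = some (haltList M₁ y)) :
    (flip bind (orTM M₁ M₂ e₁ o₁ e₂ o₂).step)^[n]
        (some (cfg M₁ M₂ A (some (Sum.inl (Sum.inl M₁.main))) M₁.initialState v₂ r b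
          (update (fun _ => []) M₁.k₀ x) S₂ i t)) =
      some (cfg M₁ M₂ A (some (Sum.inr Ctrl.mid)) M₁.initialState v₂ r b
        (update (fun _ => []) M₁.k₁ y) S₂ i t) := by
  have hemb : Embeds (Γ' := OrΓ M₁.Γ M₂.Γ A) (fun k => Sum.inl (Sum.inl k))
      (fun l => Sum.inl (Sum.inl l)) (some (Sum.inr Ctrl.mid)) set₁
      ((M₁.initialState, v₂, r, b) : St M₁.σ M₂.σ A) (mkStk (fun _ => []) S₂ i t)
      (initList M₁ x)
      (cfg M₁ M₂ A (some (Sum.inl (Sum.inl M₁.main))) M₁.initialState v₂ r b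
        (update (fun _ => []) M₁.k₀ x) S₂ i t) := by
    rw [embeds₁_iff, initList_eq]; rfl
  obtain ⟨d', hd', hdd'⟩ := iterate_lift (Γ' := OrΓ M₁.Γ M₂.Γ A)
    (κ := fun k => Sum.inl (Sum.inl k)) (fun l => Sum.inl (Sum.inl l)) (some (Sum.inr Ctrl.mid))
    (inl_inl_injective M₁ M₂) lens₁ (m := M₁.m) (m' := orStmt M₁ M₂ e₁ o₁ e₂ o₂)
    (fun l => rfl) n hemb h
  rw [embeds₁_iff, haltList_eq] at hdd'
  rw [hdd'] at hd'
  exact hd'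

/-- A run of `M₂` from `initList` to `haltList` is a run of the disjunction machine from the main
label of `M₂` to `fin`, the rest being untouched. [folklore] -/
theorem run₂ {n : ℕ} {x : List (M₂.Γ M₂.k₀)} {y : List (M₂.Γ M₂.k₁)}
    (h : (flip bind M₂.step)^[n] (some (initList M₂ x)) = some (haltList M₂ y)) :
    (flip bind (orTM M₁ M₂ e₁ o₁ e₂ o₂).step)^[n]
        (some (cfg M₁ M₂ A (some (Sum.inl (Sum.inr M₂.main))) v₁ M₂.initialState r b
          S₁ (update (fun _ => []) M₂.k₀ x) i t)) =
      some (cfg M₁ M₂ A (some (Sum.inr Ctrl.fin)) v₁ M₂.initialState r b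
        S₁ (update (fun _ => []) M₂.k₁ y) i t) := by
  have hemb : Embeds (Γ' := OrΓ M₁.Γ M₂.Γ A) (fun k => Sum.inl (Sum.inr k))
      (fun l => Sum.inl (Sum.inr l)) (some (Sum.inr Ctrl.fin)) set₂
      ((v₁, M₂.initialState, r, b) : St M₁.σ M₂.σ A) (mkStk S₁ (fun _ => []) i t)
      (initList M₂ x)
      (cfg M₁ M₂ A (some (Sum.inl (Sum.inr M₂.main))) v₁ M₂.initialState r b
        S₁ (update (fun _ => []) M₂.k₀ x) i t) := by
    rw [embeds₂_iff, initList_eq]; rfl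
  obtain ⟨d', hd', hdd'⟩ := iterate_lift (Γ' := OrΓ M₁.Γ M₂.Γ A)
    (κ := fun k => Sum.inl (Sum.inr k)) (fun l => Sum.inl (Sum.inr l)) (some (Sum.inr Ctrl.fin))
    (inl_inr_injective M₁ M₂) lens₂ (m := M₂.m) (m' := orStmt M₁ M₂ e₁ o₁ e₂ o₂)
    (fun l => rfl) n hemb h
  rw [embeds₂_iff, haltList_eq] at hdd'
  rw [hdd'] at hd'
  exact hd'

end Runs

/-! ### The whole run -/

/-- The initial configuration of the disjunction machine. [folklore] -/
theorem initList_orTM (l : List A) :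
    initList (orTM M₁ M₂ e₁ o₁ e₂ o₂) l =
      cfg M₁ M₂ A (some (Sum.inr Ctrl.init1)) M₁.initialState M₂.initialState none false
        (fun _ => []) (fun _ => []) l [] := by
  rw [initList_eq]
  change (⟨some (Sum.inr Ctrl.init1), (M₁.initialState, M₂.initialState, none, false),
      update (fun j => ([] : List (OrΓ M₁.Γ M₂.Γ A j))) (Sum.inr Aux.IN) l⟩ : OCfg M₁ M₂ A) = _
  rw [← mkStk_bot, mkStk_update_IN]
  rfl

/-- The halting configuration of the disjunction machine. [folklore] -/
theorem haltList_orTM (L : List (M₂.Γ M₂.k₁)) :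
    haltList (orTM M₁ M₂ e₁ o₁ e₂ o₂) L =
      cfg M₁ M₂ A none M₁.initialState M₂.initialState none false
        (fun _ => []) (update (fun _ => []) M₂.k₁ L) [] [] := by
  rw [haltList_eq]
  change (⟨none, (M₁.initialState, M₂.initialState, none, false),
      update (fun j => ([] : List (OrΓ M₁.Γ M₂.Γ A j))) (Sum.inl (Sum.inr M₂.k₁)) L⟩ :
      OCfg M₁ M₂ A) = _
  rw [← mkStk_bot, mkStk_update_inl_inr]
  rfl

/-- **The disjunction machine, unbundled form.** If `M₁` maps `x.map e₁.symm` to `[o₁.symm b₁]`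
within `m₁` steps and `M₂` maps `x.map e₂.symm` to `[o₂.symm b₂]` within `m₂` steps (from
`initList` to `haltList`), then the disjunction machine maps `x` to `[o₂.symm (b₁ || b₂)]` within
`m₁ + m₂ + 2 |x| + 4` steps. [cite: AroraBarak2009, §1.3 (multi-tape machine constructions; subroutines)] -/
theorem orTM_run (x : List A) (b₁ b₂ : Bool) (m₁ m₂ : ℕ)
    (h₁ : ReachesIn M₁.step (initList M₁ (x.map e₁.symm)) (haltList M₁ [o₁.symm b₁]) m₁)
    (h₂ : ReachesIn M₂.step (initList M₂ (x.map e₂.symm)) (haltList M₂ [o₂.symm b₂]) m₂) :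
    ReachesIn (orTM M₁ M₂ e₁ o₁ e₂ o₂).step (initList (orTM M₁ M₂ e₁ o₁ e₂ o₂) x)
      (haltList (orTM M₁ M₂ e₁ o₁ e₂ o₂) [o₂.symm (b₁ || b₂)]) (m₁ + m₂ + 2 * x.length + 4) := by
  obtain ⟨n₁, hn₁, r₁⟩ := h₁
  obtain ⟨n₂, hn₂, r₂⟩ := h₂
  rw [initList_orTM, haltList_orTM]
  -- init1, init2
  have s1 := init1_run M₁ M₂ e₁ o₁ e₂ o₂ M₁.initialState M₂.initialState false
    (fun _ => []) (fun _ => []) x []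
  have s2 := init2_run M₁ M₂ e₁ o₁ e₂ o₂ M₁.initialState M₂.initialState false
    (fun _ => []) (fun _ => []) ([] : List A) (x.reverse ++ [])
  simp only [List.append_nil, List.reverse_reverse, List.length_reverse] at s1 s2
  -- run `M₁`, `mid`
  have s3 : ReachesIn (C := OCfg M₁ M₂ A) (orTM M₁ M₂ e₁ o₁ e₂ o₂).step _ _ n₁ :=
    ⟨n₁, le_rfl, run₁ M₁ M₂ e₁ o₁ e₂ o₂ M₂.initialState none false
      (update (fun _ => []) M₂.k₀ (x.map e₂.symm)) [] [] r₁⟩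
  have s4 := ReachesIn.single (step_mid M₁ M₂ e₁ o₁ e₂ o₂ M₁.initialState M₂.initialState false
    (fun _ => []) (update (fun _ => []) M₂.k₀ (x.map e₂.symm)) [] [] b₁)
  rw [update_bot_nil] at s4
  -- run `M₂`, `fin`
  have s5 : ReachesIn (C := OCfg M₁ M₂ A) (orTM M₁ M₂ e₁ o₁ e₂ o₂).step _ _ n₂ :=
    ⟨n₂, le_rfl, run₂ M₁ M₂ e₁ o₁ e₂ o₂ M₁.initialState none b₁ (fun _ => []) [] [] r₂⟩
  have s6 := ReachesIn.single (step_fin M₁ M₂ e₁ o₁ e₂ o₂ M₁.initialState M₂.initialState b₁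
    (fun _ => []) (fun _ => []) [] [] b₂)
  have := ((((s1.trans s2).trans s3).trans s4).trans s5).trans s6
  refine this.mono ?_
  omega

end Bundled

end Literature.Computability.Complexity.TM2Or

/-! ### The bundled disjunction machine and its running time -/

namespace Turing.TM2ComputableAux

open Literature.Computability.Complexity Literature.Computability.Complexity.TM2Or Literature.Computability.Complexity.TM2Iter

variable {Γ₀ : Type}

/-- The disjunction of two deciders `M₁ M₂ : TM2ComputableAux Γ₀ Bool` on the same input
(`TM2Or.orTM` with `A = Γ₀` inhabited, input alphabets `M₁.inputAlphabet`, `M₂.inputAlphabet`,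
answer bits read through `M₁.outputAlphabet`, `M₂.outputAlphabet`). A deliberate dot-notation extension
of Mathlib's `Turing.TM2ComputableAux`. [cite: AroraBarak2009, §1.3 (multi-tape machine constructions; subroutines)] -/
noncomputable def orMachine [Inhabited Γ₀] (M₁ M₂ : TM2ComputableAux Γ₀ Bool) :
    TM2ComputableAux Γ₀ Bool :=
  ⟨orTM M₁.tm M₂.tm M₁.inputAlphabet M₁.outputAlphabet M₂.inputAlphabet M₂.outputAlphabet,
    Equiv.refl _, M₂.outputAlphabet⟩

/-- **Disjunction of two deciders, with additive running time.** If `M₁` maps the word `l` to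
the bit `b₁` within `m₁` steps and `M₂` maps `l` to the bit `b₂` within `m₂` steps, then
`M₁.orMachine M₂` maps `l` to `b₁ || b₂` within `m₁ + m₂ + 2 |l| + 4` steps.
[cite: AroraBarak2009, §1.3 (multi-tape machine constructions; subroutines)] -/
theorem or_outputsWithin [Inhabited Γ₀] (M₁ M₂ : TM2ComputableAux Γ₀ Bool) {l : List Γ₀}
    {b₁ b₂ : Bool} {m₁ m₂ : ℕ} (h₁ : M₁.OutputsWithin l [b₁] m₁) (h₂ : M₂.OutputsWithin l [b₂] m₂) :
    (M₁.orMachine M₂).OutputsWithin l [b₁ || b₂] (m₁ + m₂ + 2 * l.length + 4) := by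
  have r₁ := reachesIn_of_outputsWithin M₁ h₁
  have r₂ := reachesIn_of_outputsWithin M₂ h₂
  simp only [List.map_cons, List.map_nil] at r₁ r₂
  apply outputsWithin_of_reachesIn
  have H := orTM_run M₁.tm M₂.tm M₁.inputAlphabet M₁.outputAlphabet M₂.inputAlphabet
    M₂.outputAlphabet l b₁ b₂ m₁ m₂ r₁ r₂
  have e : (l.map (M₁.orMachine M₂).inputAlphabet.symm) = l := List.map_id _
  rw [e]
  exact H

end Turing.TM2ComputableAux
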